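/-
Copyright: statement-level skeleton of a published paper (lit-balaban cell, Phase-2 proof seat p25, gen 18). No proof
claims beyond what the kernel checks below.
-/
import Literature.MathematicalPhysics.QuantumFieldTheory.BalabanImbrieJaffe1984to88.BIJ88WalkBlockActivity312
import Literature.MathematicalPhysics.QuantumFieldTheory.BalabanImbrieJaffe1984to88.BIJ88WalkSplitInstance311
import Literature.MathematicalPhysics.QuantumFieldTheory.BalabanImbrieJaffe1984to88.BIJ88WalkResummation312

/-!
# `BalabanImbrieJaffe1984to88.BIJ88WalkBlockActivityLoc312` — T. Bałaban, J. Imbrie, A. Jaffe, *Effective action and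
cluster properties of the abelian Higgs model*, Commun. Math. Phys. **114** (1988) 257–315 [BalabanImbrieJaffe1988],
§5.14 p. 310–312 [PDF 54–56], verbatim: *"We give random walk expansions for the propagators … The leading terms …
we transform further. The others, localized in region X, have a factor of e^{−cr(e_k)|X|}"*, *"Summing all possible
diagrams in X_c gives the observable for the next step there, F^L_{k+1,loc}(X_c)."*, *"|G_k(X)| ≤
c(F(X))(e^β(L^kε/ε₀)^{1/4−α})^{β′|X∖∪X_c|} Π [c(L^kε)^{−m(c)}e^{−m′(c)}]"* (DOCFIX v1.1, r16 gen 26 as C2 §5 owner on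
referee ref-1's F1 ask, gens 80–88: v1.0 had «gives the constant observable F^L_{k+1,loc}(X_c)» inside the quotation
marks; print `p0056.txt` L3–4 re-read 2026-08-23; declarations untouched) — **THE CONSTANT-COMPONENT ACTIVITY AT A
CUBE SET, FOR THE PRINTED SPLIT
`C = C_loc + Σ_ω D_ω`, AND ITS RESUMMATION OVER THE CUBE SETS** (p25 gen 18): (i) summed over the cube sets `X`, the
localized activities `flAt i B X` of `BIJ88WalkBlockActivity312` give back the constant component `F^L(i, B)` of the
resummation (`BIJ88WalkResummation312.fl`): the localization loses nothing; (ii) for the printed split — `C_loc` with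
brackets `≤ B_ℓ` on the admissible directions, the walk term `D_ω` with brackets `≤ θ^{#Rg ω}·ρ_ω` where
`1 + Σ_{ω : D_ω u ≠ 0} ρ_ω ≤ ρ₀` for every admissible `u` (the walks seeing a leg start at its cube: summable by their
small factors), couplings with `cV m·B_ℓ^{|legs m|} ≤ θ^{#vc m}` —
`flAbsAt i B X ≤ W^Φ · (Π_{j∈{i}∪B} B_ℓ^{|obs j|}) · θ^{#(X ∖ observable cubes)}`, uniformly in the number of walks and of
vertices.

statement-level skeleton of published theorems with citation tags; proofs where landed; nothing here is a claim
about the Yang–Mills mass gap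

PDF held: `paper:balaban1988-cmp114-bij-abelian-higgs-effective-action` (journal page = PDF page + 256); p. 310–312 =
PDF 54–56 (`p0054.txt` L24–31, `p0055.txt` L23–38, `p0056.txt` L1–25 re-read this session, 2026-08-22).

CITATION HEADER (lean-in-tree rule).  lit-balaban cell (HOME `run/shared/lean/pub/lit-balaban/`), Phase 2, seat p25
gen 18; row **C2.Claim@312** of `HOME/lit-balaban-r16/ROWS-C2-part2.md` (owner r16, referee ref-5; head
`BIJ88Sect5StatementsPart4.Ineq312` untouched — MEMBER of the row).  USED BY NAME, nothing restated:
`BIJ88WalkBlockActivity312.{flAt, flAbsAt, flAbsAt_le}`, `BIJ88WalkSplitInstance311.{covOf, trigOf, regOf,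
trigOf_eq_false_iff}`, `BIJ88WalkResummation312.fl`, `BIJ88WalkGeometry311.cubes`, `BIJ88WalkRun311.{run, pristine}`
(this seat and generation), `BIJ88Resummation312.sum_map_finset_sum_comm` (p25 gen 17), `BIJ88VertexComponents311.maxArity`.

## What is proved (0 `sorry`, standard axioms, no new `Prop` facts; theorems only)

* §1 **`sum_flAt_eq_fl`**: `Σ_{X ∈ cube sets of the run} flAt i B X = fl i B`.
* §2 **`flAbsAt_loc_le`**: the bound of `BIJ88WalkBlockActivity312.flAbsAt_le` for the printed split, every input
  about `C_loc` and the walk terms `D_ω` separately.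
HONEST SCOPE: (a) constant components only; (b) the finite range of `C_loc`, the start of the walks at the cube of
the leg, the convergence `Σ ρ_ω` and the number `N₀` of coupled vertex legs are HYPOTHESES in abstract form; (c) the
combinatorial constant is `W^Φ`; (d) contraction-graph components; (e) no `Ineq312` binder.  NOT summit progress;
NOT continuum; NOT Clay.  Imports `BIJ88WalkBlockActivity312`, `BIJ88WalkSplitInstance311`,
`BIJ88WalkResummation312`; modifies nothing.
-/

noncomputable section

namespace Literature.MathematicalPhysics.QuantumFieldTheory.BalabanImbrieJaffe1984to88.BIJ88WalkBlockActivityLoc312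

open Classical Matrix Finset
open scoped BigOperators
open BIJ88VertexComponents311 (maxArity)
open BIJ88Resummation312 (sum_map_finset_sum_comm)
open BIJ88WalkRun311 BIJ88WalkRunEnv311 BIJ88WalkGeometry311 BIJ88WalkSplitInstance311 BIJ88WalkResummation312
  BIJ88WalkBlockActivity312

variable {S : Type} [Fintype S] {ι : Type} [Fintype ι] {κ : Type} [LinearOrder κ] {P : Type} [Fintype P]
  {β : Type} [DecidableEq β]

/-! ## §1  The localization loses nothing -/

section Resum

variable {Cov : P → Matrix S S ℝ} {trig : P → Bool} {f : S → ℝ} {c : ι → ℝ} {legs : ι → List (S → ℝ)}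
  {obs : κ → List (S → ℝ)} {M : ℕ} {oc : κ → Finset β} {vc : ι → Finset β} {reg : P → Finset β}

omit [Fintype S] [Fintype ι] [LinearOrder κ] [Fintype P] [DecidableEq β] in
/-- A sum of indicators is the sum over the filter (bookkeeping). [folklore] -/
private theorem sum_map_ite {α : Type} (m : Multiset α) (q : α → Prop) [DecidablePred q] (F : α → ℝ) :
    (m.map fun x => if q x then F x else 0).sum = ((m.filter q).map F).sum := by
  induction m using Multiset.induction_on with
  | empty => simp
  | cons a m ih =>
    by_cases h : q a
    · simp [h, ih]
    · simp [h, ih]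

/-- **SUMMED OVER THE CUBE SETS, THE LOCALIZED ACTIVITIES GIVE BACK THE CONSTANT COMPONENT `F^L(i, B)`**:
`Σ_{X} flAt i B X = fl i B`, the sum over the cube sets of the outcomes of the run (outside which `flAt i B X = 0`).
[cite: BalabanImbrieJaffe1988, §5.14 p.312] -/
theorem sum_flAt_eq_fl (i : κ) (B : Finset κ) :
    ∑ X ∈ ((run Cov trig f c legs obs M (pristine obs i) B 0).map fun o => cubes oc vc reg o.g).toFinset,
        flAt Cov trig f c legs obs M oc vc reg i B X
      = fl Cov trig f c legs obs M i B := by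
  simp only [flAt]
  rw [← sum_map_finset_sum_comm, fl, ← sum_map_ite]
  refine congrArg _ (Multiset.map_congr rfl fun o ho => ?_)
  by_cases hq : o.g.IsConst M ∧ o.rest = ∅
  · have hmem : cubes oc vc reg o.g ∈
        ((run Cov trig f c legs obs M (pristine obs i) B 0).map fun o => cubes oc vc reg o.g).toFinset :=
      Multiset.mem_toFinset.2 (Multiset.mem_map.2 ⟨o, ho, rfl⟩)
    rw [if_pos hq]
    simp only [hq, true_and]
    rw [Finset.sum_ite_eq, if_pos hmem]
  · rw [if_neg hq]
    refine Finset.sum_eq_zero fun X _ => ?_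
    rw [if_neg fun h => hq ⟨h.1, h.2.1⟩]

end Resum

/-! ## §2  The bound for the printed split -/

section Loc

variable {Ω : Type} [Fintype Ω] {Cl : Matrix S S ℝ} {D : Ω → Matrix S S ℝ} {f : S → ℝ} {c : ι → ℝ}
  {legs : ι → List (S → ℝ)} {obs : κ → List (S → ℝ)} {M : ℕ} {oc : κ → Finset β} {vc : ι → Finset β}
  {Rg : Ω → Finset β}

/-- The counting weight of the printed split, summed over the pieces seeing a leg (bookkeeping): the local piece
counts at most `1`, the walk terms their `ρ_ω`. [cite: BalabanImbrieJaffe1988, §5.14 p.311] -/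
private theorem sum_filter_option_le (ρW : Ω → ℝ) (u : S → ℝ) :
    (∑ p ∈ univ.filter (fun p : Option Ω => covOf Cl D p *ᵥ u ≠ 0), (p.elim 1 ρW : ℝ))
      ≤ 1 + ∑ ω ∈ univ.filter (fun ω => D ω *ᵥ u ≠ 0), ρW ω := by
  rw [Finset.sum_filter, Finset.sum_filter, Fintype.sum_option]
  refine add_le_add ?_ (le_of_eq (Finset.sum_congr rfl fun ω _ => by simp [covOf]))
  split_ifs
  · exact le_rfl
  · exact zero_le_one

/-- **THE CONSTANT-COMPONENT ACTIVITY AT `X` FOR `C = C_loc + Σ_ω D_ω`**: observables and vertex legs with directions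
in `Dir`; `C_loc` with `|⟨C_loc u, w⟩|, |⟨C_loc u, f⟩|, ‖C_loc u‖ ≤ B_ℓ` (`B_ℓ ≥ 1`); the walk term `D_ω` with the same
three brackets `≤ θ^{#Rg ω}·ρ_ω` (`0 < θ ≤ 1`, `ρ_ω ≥ 0`) and `1 + Σ_{ω : D_ω u ≠ 0} ρ_ω ≤ ρ₀` for `u ∈ Dir`;
couplings `|c m| ≤ cV m`, `cV m·B_ℓ^{|legs m|} ≤ θ^{#vc m}`; at most `N₀` (vertex, leg) pairs coupled to `C_loc u`,
and to each `D_ω u`; `i ∉ B`, `W ≥ 1`, `ρ₀·(Φ + N₀) ≤ W`, `Φ = |obs i| + 1 + M·maxArity + Σ_{j∈B}|obs j|`.  Then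
`flAbsAt i B X ≤ W^Φ · (Π_{j∈{i}∪B} B_ℓ^{|obs j|}) · θ^{#(X ∖ ⋃_{j∈{i}∪B} oc j)}` for every cube set `X`.
[cite: BalabanImbrieJaffe1988, §5.14 p.312] -/
theorem flAbsAt_loc_le {Dir : Set (S → ℝ)} {ρW : Ω → ℝ} {cV : ι → ℝ} {Bl θ ρ₀ W : ℝ} {N₀ : ℕ}
    (hθ0 : 0 < θ) (hθ1 : θ ≤ 1) (hBl : 1 ≤ Bl) (hρW0 : ∀ ω, 0 ≤ ρW ω) (hcV0 : ∀ m, 0 ≤ cV m)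
    (hBl2 : ∀ u ∈ Dir, ∀ w ∈ Dir, |(Cl *ᵥ u) ⬝ᵥ w| ≤ Bl) (hBlf : ∀ u ∈ Dir, |(Cl *ᵥ u) ⬝ᵥ f| ≤ Bl)
    (hBlz : ∀ u ∈ Dir, ‖Cl *ᵥ u‖ ≤ Bl)
    (hW2 : ∀ ω, ∀ u ∈ Dir, ∀ w ∈ Dir, |(D ω *ᵥ u) ⬝ᵥ w| ≤ θ ^ (Rg ω).card * ρW ω)
    (hWf : ∀ ω, ∀ u ∈ Dir, |(D ω *ᵥ u) ⬝ᵥ f| ≤ θ ^ (Rg ω).card * ρW ω)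
    (hWz : ∀ ω, ∀ u ∈ Dir, ‖D ω *ᵥ u‖ ≤ θ ^ (Rg ω).card * ρW ω)
    (hρ₀ : ∀ u ∈ Dir, 1 + ∑ ω ∈ univ.filter (fun ω => D ω *ᵥ u ≠ 0), ρW ω ≤ ρ₀)
    (hcV : ∀ m, |c m| ≤ cV m) (hobs : ∀ j, ∀ w ∈ obs j, w ∈ Dir) (hlegs : ∀ m, ∀ w ∈ legs m, w ∈ Dir)
    (hvert : ∀ m, cV m * Bl ^ (legs m).length ≤ θ ^ (vc m).card)
    (hNl : ∀ u ∈ Dir, (∑ m, ((range (legs m).length).filter fun j => (Cl *ᵥ u) ⬝ᵥ (legs m).getD j 0 ≠ 0).card) ≤ N₀)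
    (hNw : ∀ ω, ∀ u ∈ Dir,
      (∑ m, ((range (legs m).length).filter fun j => (D ω *ᵥ u) ⬝ᵥ (legs m).getD j 0 ≠ 0).card) ≤ N₀)
    {i : κ} {B : Finset κ} (hi : i ∉ B) (hW1 : 1 ≤ W)
    (hW : ρ₀ * (((obs i).length + 1 + M * maxArity legs + ∑ j ∈ B, (obs j).length + N₀ : ℕ) : ℝ) ≤ W)
    (X : Finset β) :
    flAbsAt (covOf Cl D) trigOf f c legs obs M oc vc (regOf Rg) i B X
      ≤ W ^ ((obs i).length + 1 + M * maxArity legs + ∑ j ∈ B, (obs j).length)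
        * ((∏ j ∈ insert i B, Bl ^ (obs j).length) * θ ^ (X \ (insert i B).biUnion oc).card) := by
  refine flAbsAt_le (B' := fun p => p.elim Bl fun ω => θ ^ (Rg ω).card) (ρ := fun p => p.elim 1 ρW) hθ0 hθ1 hBl
    (fun p => ?_) (fun p => ?_) hcV0 (fun p u hu w hw => ?_) (fun p u hu => ?_) (fun p u hu => ?_) hcV hobs hlegs
    (fun p hp => ?_) (fun p hp => ?_) hvert (fun u hu => (sum_filter_option_le ρW u).trans (hρ₀ u hu))
    (fun p u hu => ?_) hi hW1 hW X
  · cases p with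
    | none => exact zero_le_one.trans hBl
    | some ω => exact pow_nonneg hθ0.le _
  · cases p with
    | none => exact zero_le_one
    | some ω => exact hρW0 ω
  · cases p with
    | none => simpa using hBl2 u hu w hw
    | some ω => simpa using hW2 ω u hu w hw
  · cases p with
    | none => simpa using hBlf u hu
    | some ω => simpa using hWf ω u hu
  · cases p with
    | none => simpa using hBlz u hu
    | some ω => simpa using hWz ω u hu
  · rw [trigOf_eq_false_iff] at hp
    subst hp
    exact ⟨le_rfl, rfl⟩
  · cases p with
    | none => exact absurd hp (by simp)
    | some ω => exact le_rfl
  · cases p with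
    | none => simpa using hNl u hu
    | some ω => simpa using hNw ω u hu

end Loc

end Literature.MathematicalPhysics.QuantumFieldTheory.BalabanImbrieJaffe1984to88.BIJ88WalkBlockActivityLoc312

end
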